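import Summits.QuantumFields.YangMills.Theorems.UnitScaleTiltProp7TwistedOneStepDefectFlat
import Summits.QuantumFields.YangMills.Theorems.UnitScaleTiltProp7SymFrameAnalytic
import Summits.QuantumFields.YangMills.Theorems.UnitScaleTiltProp7SymFrameCovLocality
import Summits.QuantumFields.YangMills.Theorems.UnitScaleTiltProp7AnalyticRemainderInputs
import Summits.QuantumFields.YangMills.Theorems.UnitScaleTiltProp8ChartDiffLocal
import HarnessLib

/-!
# Route `UnitScaleTilt`, crux K1 «MinimiserStabilityRegPr» (stmt-QuantumFields-19200), E′ architecture (A′) «HCOW-VIA-Σ» (★★OWNER RULING g28-№13), package P-A2 «JOINT-Σ»,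
# file F1″(cov) — THE ONE-STEP DEFECT OF THE COVARIANT DOUBLE BAR (89) IN MASS CURRENCY AT A BOND-SMALL BACKGROUND, BY CAUCHY ESTIMATES:
# `‖log[(V̿₁V̄₀)(c)·V̄₀(c)⁻¹](y) − D|₀(…)·y‖ ≤ (80·B∕R²)·Σ_{b read by c}‖y b‖²` and `Σ_c (…) ≤ (80·B∕R²)·2d·Σ_b ‖y b‖²`
# (`W = e^{y}U₀`, `‖U₀ b − 1‖ ≤ s₀`, `‖y b‖ ≤ s`, `2s < R`, window `1000ℓ(2s₀ + 3R) ≤ 1`, `B = 3LR + 22100ℓ²(2s₀+3R)²`, `ℓ = (d+2)L`)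

Cell `ym3-torus`, extra width seat `ym-routeR-w6` (gen 7); ★routeR-w3 g6 LOCATE-PA2-JOINT-SIGMA (bc08ddff) §2 F1″ «covariant second»; ★p1 g17 WORD 10 (4) pen.  THEOREMS ONLY
(0 `def`, 0 `sorry`); `--supports stmt-QuantumFields-19200`, count-neutral.  YM₃ on T³ is a ladder rung (R3), not the Clay problem; nothing here claims a stub, the crux,
d = 4 or the mass gap.

THE POINT.  The level-`l` map of the (A′) tower is `f_l(y)(c) = log[(dbarCovU Ū₀ˡ (e^{y}Ū₀ˡ))(c)·(Ū₀^{l+1}(c))⁻¹]` (✓`Prop7SymAvgTwSym.dbarCovIterU_succ`, ✓`dbarCovU_self`), with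
`T_l := D f_l(0)`.  Its second-order defect needs no explicit covariant tube: the chart is ANALYTIC on the sup-ball `‖y‖ < R` (W4 ✓`Prop7SymFrameBound.analyticAt_coe_dbarCovU_of_twoBlock`
+ `MatrixLog.analyticAt_mlog`), BOUNDED there by `2B` (W3 ✓`Prop7SymAvgTwSym.norm_dbarCovU_mul_inv_sub_one_le` + `norm_mlog_le_two_mul`), vanishes at `0` (✓`dbarCovU_self`), so
★w2-20520 g2's Cauchy letter ✓`Prop7AnalyticRemainderInputs.norm_le_mul_sq` gives `‖f(y) − f(0) − Df(0)y‖ ≤ 40·(2B)∕R²·‖y‖²_sup`; LOCALITY (✓`Prop7SymFrameCovLocality.dbarCovU_congr₂`,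
and the derivative inherits it) replaces the global sup by the read-set sup, whose square is `≤ Σ_{read}‖y b‖²` (F1″(flat) §1 ✓`exists_local_radius`), and the multiplicity count
✓`sum_read_le_two_d_mul` sums over `c`.

WHAT IS PROVED (ns `…Theorems.Prop7TwistedOneStepDefectCov`; any `P`, `j + 1 ≤ m + K`, complete normed ℂ-algebra `𝔸`, `‖1‖ = 1`; the chart is written INLINE,
`y ↦ mlog (↑(dbarCovU U₀ (b ↦ expUnit (y b)·U₀ b) c)·↑(emlAvgU U₀ c)⁻¹)`).
* §1 letters on the ball: `norm_pert_sub_le` (`‖e^{y}U₀ − U₀‖ ≤ 3ρ`, `‖e^{y}U₀ − 1‖ ≤ s₀ + 3ρ`), `window_numerics`, `norm_ratio_sub_one_le` (`≤ B`), `chart_zero`, `chart_congr` (locality).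
* §2 `analyticAt_chart` (every point of the ball), `norm_chart_le` (`≤ 2B`), `fderiv_chart_congr` (the derivative at `0` is local too).
* §3 ★★ `norm_chart_sub_fderiv_le_localMass` — per coarse bond, local hypotheses only.
* §4 ★★★ `sum_norm_chart_sub_fderiv_le` — summed over the coarse bonds at a globally bond-small background; `sum_norm_chartField_sub_fderiv_apply_le` — the same with
  `T := fderiv` of the FIELD-valued map `y ↦ (c ↦ f(y)(c))` (the letter F0″ telescopes with).
HONEST SCOPE.  Bookkeeping over landed W3∕W4∕Cauchy letters; constants crude (`80B∕R² ∝ ℓ²` at `R ∝ ℓ⁻¹`).  BOND-smallness of the background is DISPLAYED: for the `RegPr`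
tower it holds only blockwise after a block axial gauge, so the T³ reading (gauge covariance ✓`Prop7SymFrameCovariance` + W2 rows) is a companion file, as for
✓`Prop7SymAvgJointAnalytic` → `…QSymCovDefectOfRegPr`.  Background `1`, explicit tube: F1″(flat) ✓`Prop7TwistedOneStepDefectFlat`.

References: T. Bałaban, CMP 98 (1985) 17–51 [Balaban1985Averaging] ((11)–(12) p.19, (58) p.27, (82) p.30, (89) p.31, (121)–(125) p.36, Prop. 4 p.38); CMP 102 (1985) 277–309
[Balaban1985Variational] ((44)–(46) p.285, Prop. 7 p.299); CMP 109 (1987) 249–301 [Balaban1987RG1] ((0.4) p.253, (0.21) p.256).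
-/

set_option autoImplicit false

noncomputable section

open scoped BigOperators
open NormedSpace Metric Set Finset

namespace Summit.QuantumFields.YangMills.Theorems.Prop7TwistedOneStepDefectCov

open Literature.MathematicalPhysics.QuantumFieldTheory.Balaban1983to89
open T4Continuum BlockAveraging AveragingRT ExpMeanLog MatrixLog
open B7Prop1Explicit (expUnit val_expUnit norm_exp_sub_one_le_of_norm_le)
open B12Average012Analytic (analyticAt_units_inv)
open Summit.QuantumFields.YangMills.Theorems.Prop8Chart (emlAvgU loopHolU norm_loopHolU_sub_one_lt_one)
open Summit.QuantumFields.YangMills.Theorems.Prop7SymAvgTwSym (tstairU vframeCovU dbarCovU dbarCovU_self norm_dbarCovU_mul_inv_sub_one_le)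
open Summit.QuantumFields.YangMills.Theorems.Prop7SymFrameBound (analyticAt_coe_dbarCovU_of_twoBlock norm_tstairU_sub_one_lt_one)
open Summit.QuantumFields.YangMills.Theorems.Prop7SymFrameCovLocality (dbarCovU_congr₂)
open Summit.QuantumFields.YangMills.Theorems.Prop7AnalyticRemainderInputs (norm_le_mul_sq norm_fderiv_le_of_bound)
open Summit.QuantumFields.YangMills.Theorems.Prop7TwistedOneStepDefectFlat (exists_local_radius sum_read_le_two_d_mul)

variable {P : Params} {j : ℕ}
variable {𝔸 : Type*} [NormedRing 𝔸] [NormedAlgebra ℂ 𝔸] [CompleteSpace 𝔸] [NormOneClass 𝔸]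

/-! ## §1 Letters on the ball -/

/-- **THE PERTURBED FIELD AGAINST THE BACKGROUND AND AGAINST `1`**: `‖U₀ b − 1‖ ≤ s₀ ≤ ½`, `‖y b‖ ≤ ρ ≤ 1` give `‖e^{y b}U₀ b − U₀ b‖ ≤ 3ρ` and `‖e^{y b}U₀ b − 1‖ ≤ s₀ + 3ρ`.
[cite: Balaban1985Averaging, (11)–(12) p.19] -/
theorem norm_pert_sub_le {U₀ : GaugeField P j 𝔸ˣ} {y : PBond P j → 𝔸} {b : PBond P j} {s₀ ρ : ℝ} (hs₀ : s₀ ≤ 1 / 2) (hρ : ρ ≤ 1)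
    (hU : ‖((U₀ b : 𝔸ˣ) : 𝔸) - 1‖ ≤ s₀) (hy : ‖y b‖ ≤ ρ) :
    ‖((expUnit (y b) * U₀ b : 𝔸ˣ) : 𝔸) - ((U₀ b : 𝔸ˣ) : 𝔸)‖ ≤ 3 * ρ ∧ ‖((expUnit (y b) * U₀ b : 𝔸ˣ) : 𝔸) - 1‖ ≤ s₀ + 3 * ρ := by
  have hρ0 : 0 ≤ ρ := (norm_nonneg _).trans hy
  have hU1 : ‖((U₀ b : 𝔸ˣ) : 𝔸)‖ ≤ 1 + s₀ := by
    have := norm_le_norm_add_norm_sub' ((U₀ b : 𝔸ˣ) : 𝔸) 1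
    rw [norm_one] at this; linarith [norm_sub_rev ((U₀ b : 𝔸ˣ) : 𝔸) 1]
  have hexp : ‖exp (y b) - 1‖ ≤ 2 * ‖y b‖ := by
    have h1 : ‖exp (y b) - 1‖ ≤ Real.exp ‖y b‖ - 1 := (norm_exp_sub_one_le_of_norm_le le_rfl).1
    have h2 : Real.exp ‖y b‖ - 1 ≤ 2 * ‖y b‖ := by
      have h := Real.abs_exp_sub_one_le (x := ‖y b‖) (by rw [abs_of_nonneg (norm_nonneg _)]; exact hy.trans hρ)
      rw [abs_of_nonneg (norm_nonneg _)] at h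
      exact (le_abs_self _).trans h
    linarith
  have hd : ‖((expUnit (y b) * U₀ b : 𝔸ˣ) : 𝔸) - ((U₀ b : 𝔸ˣ) : 𝔸)‖ ≤ 3 * ρ := by
    rw [Units.val_mul, val_expUnit, show exp (y b) * ((U₀ b : 𝔸ˣ) : 𝔸) - ((U₀ b : 𝔸ˣ) : 𝔸) = (exp (y b) - 1) * ((U₀ b : 𝔸ˣ) : 𝔸) by
      rw [sub_mul, one_mul]]
    refine (norm_mul_le _ _).trans ?_
    have h1 := mul_le_mul hexp hU1 (norm_nonneg _) (by positivity)
    have hs₀0 : 0 ≤ s₀ := (norm_nonneg _).trans hU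
    have h2 : 2 * ‖y b‖ * (1 + s₀) ≤ 2 * ρ * (1 + 1 / 2) := mul_le_mul (by linarith) (by linarith) (by linarith) (by positivity)
    linarith
  refine ⟨hd, ?_⟩
  calc ‖((expUnit (y b) * U₀ b : 𝔸ˣ) : 𝔸) - 1‖
      = ‖(((expUnit (y b) * U₀ b : 𝔸ˣ) : 𝔸) - ((U₀ b : 𝔸ˣ) : 𝔸)) + (((U₀ b : 𝔸ˣ) : 𝔸) - 1)‖ := by rw [sub_add_sub_cancel]
    _ ≤ 3 * ρ + s₀ := (norm_add_le _ _).trans (add_le_add hd hU)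
    _ = s₀ + 3 * ρ := by ring

omit [NormedAlgebra ℂ 𝔸] [CompleteSpace 𝔸] [NormOneClass 𝔸] in
/-- **THE WINDOW NUMERICS**: `1000ℓ(2s₀ + 3R) ≤ 1` (with `ℓ ≥ 1`, `s₀, R ≥ 0`) gives the W3 window `120ℓ(2s₀+3R) ≤ 1`, the loop∕stair windows `4ℓ(s₀+3R) < 1`,
`16ℓ(s₀+3R) ≤ 1`, `R ≤ 1`, `s₀ ≤ ½`, and the size `B := 3LR + 22100ℓ²(2s₀+3R)² ≤ 1∕40`. [folklore] -/
theorem window_numerics {s₀ R : ℝ} (hs₀ : 0 ≤ s₀) (hR : 0 ≤ R) (hwin : 1000 * (((P.d + 2) * P.L : ℕ) : ℝ) * (2 * s₀ + 3 * R) ≤ 1) :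
    120 * (((P.d + 2) * P.L : ℕ) : ℝ) * (s₀ + (s₀ + 3 * R)) ≤ 1 ∧ 4 * (((P.d + 2) * P.L : ℕ) : ℝ) * (s₀ + 3 * R) < 1 ∧
      16 * (((P.d + 2) * P.L : ℕ) : ℝ) * (s₀ + 3 * R) ≤ 1 ∧ R ≤ 1 ∧ s₀ ≤ 1 / 2 ∧
      (P.L : ℝ) * (3 * R) + 22100 * (((P.d + 2) * P.L : ℕ) : ℝ) ^ 2 * (s₀ + (s₀ + 3 * R)) ^ 2 ≤ 1 / 40 := by
  have hL1 : (1 : ℝ) ≤ P.L := by exact_mod_cast P.L_pos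
  have hℓ1 : (1 : ℝ) ≤ (((P.d + 2) * P.L : ℕ) : ℝ) := by push_cast; nlinarith [show (0:ℝ) ≤ P.d from Nat.cast_nonneg _]
  have hLℓ : (P.L : ℝ) ≤ (((P.d + 2) * P.L : ℕ) : ℝ) := by push_cast; nlinarith [show (0:ℝ) ≤ P.d from Nat.cast_nonneg _]
  set ℓ : ℝ := (((P.d + 2) * P.L : ℕ) : ℝ) with hℓ
  have hθ0 : 0 ≤ ℓ * (2 * s₀ + 3 * R) := by positivity
  have hθ : ℓ * (2 * s₀ + 3 * R) ≤ 1 / 1000 := by linarith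
  have h23 : 2 * s₀ + 3 * R ≤ ℓ * (2 * s₀ + 3 * R) := by nlinarith
  refine ⟨by nlinarith, by nlinarith, by nlinarith, by nlinarith, by nlinarith, ?_⟩
  have h1 : (P.L : ℝ) * (3 * R) ≤ ℓ * (2 * s₀ + 3 * R) := by nlinarith
  have h2 : 22100 * ℓ ^ 2 * (s₀ + (s₀ + 3 * R)) ^ 2 = 22100 * ((ℓ * (2 * s₀ + 3 * R)) * (ℓ * (2 * s₀ + 3 * R))) := by ring
  rw [h2]
  nlinarith [mul_le_mul hθ hθ hθ0 (by norm_num : (0:ℝ) ≤ 1 / 1000)]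

/-- **THE COVARIANT DOUBLE BAR OF `e^{y}U₀` AGAINST `Ū₀` IS WITHIN `B` OF `1` ON THE BALL** (W3 ✓`norm_dbarCovU_mul_inv_sub_one_le` at `δ := 3ρ`, `s₁ := s₀ + 3ρ`, `ρ ≤ R`).
[cite: Balaban1985Averaging, (89) p.31, (121)–(125) p.36] -/
theorem norm_ratio_sub_one_le (hj : j + 1 ≤ P.m + P.K) (U₀ : GaugeField P j 𝔸ˣ) (c : PBond P (j + 1)) {s₀ R ρ : ℝ} (hs₀ : 0 ≤ s₀) (hρ0 : 0 ≤ ρ) (hρR : ρ ≤ R)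
    (hwin : 1000 * (((P.d + 2) * P.L : ℕ) : ℝ) * (2 * s₀ + 3 * R) ≤ 1)
    (hU₀ : ∀ b : PBond P j, (blockOf b.src = c.src ∨ blockOf b.src = c.tgt) → (blockOf b.tgt = c.src ∨ blockOf b.tgt = c.tgt) → ‖((U₀ b : 𝔸ˣ) : 𝔸) - 1‖ ≤ s₀)
    {y : PBond P j → 𝔸} (hy : ∀ b : PBond P j, (blockOf b.src = c.src ∨ blockOf b.src = c.tgt) → (blockOf b.tgt = c.src ∨ blockOf b.tgt = c.tgt) → ‖y b‖ ≤ ρ) :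
    ‖((dbarCovU U₀ (fun b => expUnit (y b) * U₀ b) c : 𝔸ˣ) : 𝔸) * (((emlAvgU U₀ c)⁻¹ : 𝔸ˣ) : 𝔸) - 1‖ ≤
      (P.L : ℝ) * (3 * R) + 22100 * (((P.d + 2) * P.L : ℕ) : ℝ) ^ 2 * (s₀ + (s₀ + 3 * R)) ^ 2 := by
  have hR : 0 ≤ R := hρ0.trans hρR
  obtain ⟨h120, -, -, hR1, hs₀h, -⟩ := window_numerics (P := P) hs₀ hR hwin
  have hpert : ∀ b : PBond P j, (blockOf b.src = c.src ∨ blockOf b.src = c.tgt) → (blockOf b.tgt = c.src ∨ blockOf b.tgt = c.tgt) →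
      ‖((expUnit (y b) * U₀ b : 𝔸ˣ) : 𝔸) - ((U₀ b : 𝔸ˣ) : 𝔸)‖ ≤ 3 * R ∧ ‖((expUnit (y b) * U₀ b : 𝔸ˣ) : 𝔸) - 1‖ ≤ s₀ + 3 * R := by
    intro b h1 h2
    have h := norm_pert_sub_le (hs₀ := hs₀h) (hρ := hρR.trans hR1) (hU₀ b h1 h2) (hy b h1 h2)
    exact ⟨h.1.trans (by linarith), h.2.trans (by linarith)⟩
  exact norm_dbarCovU_mul_inv_sub_one_le hj c hs₀ (by positivity) (by positivity) h120 hU₀ (fun b h1 h2 => (hpert b h1 h2).2) (fun b h1 h2 => (hpert b h1 h2).1)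

omit [NormOneClass 𝔸] in
/-- **AT `y = 0` THE CHART VANISHES**: `e^{0}U₀ = U₀`, `dbarCovU U₀ U₀ = Ū₀` (✓`dbarCovU_self`), `Ū₀(c)·Ū₀(c)⁻¹ = 1`, `log 1 = 0`. [cite: Balaban1985Averaging, (89) p.31] -/
theorem chart_zero (U₀ : GaugeField P j 𝔸ˣ) (c : PBond P (j + 1)) :
    mlog (((dbarCovU U₀ (fun b => expUnit ((0 : PBond P j → 𝔸) b) * U₀ b) c : 𝔸ˣ) : 𝔸) * (((emlAvgU U₀ c)⁻¹ : 𝔸ˣ) : 𝔸)) = 0 := by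
  have h0 : (fun b => expUnit ((0 : PBond P j → 𝔸) b) * U₀ b) = U₀ := by
    funext b
    have : expUnit ((0 : PBond P j → 𝔸) b) = 1 := by apply Units.ext; rw [val_expUnit, Pi.zero_apply, exp_zero, Units.val_one]
    rw [this, one_mul]
  rw [h0, dbarCovU_self, ← Units.val_mul, mul_inv_cancel, Units.val_one, mlog_one]

omit [NormOneClass 𝔸] in
/-- **LOCALITY OF THE CHART**: it reads `y` only on the bonds with both ends in the two blocks of `c` (✓`dbarCovU_congr₂`). [cite: Balaban1985Averaging, (87)–(92) p.31] -/
theorem chart_congr (hj : j + 1 ≤ P.m + P.K) (U₀ : GaugeField P j 𝔸ˣ) (c : PBond P (j + 1)) {y y' : PBond P j → 𝔸}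
    (hyy' : ∀ b : PBond P j, (blockOf b.src = c.src ∨ blockOf b.src = c.tgt) → (blockOf b.tgt = c.src ∨ blockOf b.tgt = c.tgt) → y b = y' b) :
    mlog (((dbarCovU U₀ (fun b => expUnit (y b) * U₀ b) c : 𝔸ˣ) : 𝔸) * (((emlAvgU U₀ c)⁻¹ : 𝔸ˣ) : 𝔸)) =
      mlog (((dbarCovU U₀ (fun b => expUnit (y' b) * U₀ b) c : 𝔸ˣ) : 𝔸) * (((emlAvgU U₀ c)⁻¹ : 𝔸ˣ) : 𝔸)) := by
  rw [dbarCovU_congr₂ hj U₀ c (W := fun b => expUnit (y b) * U₀ b) (W' := fun b => expUnit (y' b) * U₀ b) (fun b h1 h2 => by simp only [hyy' b h1 h2])]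

/-! ## §2 Analyticity and size of the chart on the ball; locality of the derivative -/

/-- **THE CHART IS ANALYTIC AT EVERY POINT OF THE BALL `‖y‖ < R`** (W4 ✓`analyticAt_coe_dbarCovU_of_twoBlock` at the bondwise-analytic family `y ↦ e^{y b}U₀ b`, loops and
twisted stairs within `1` of `1` by §1, times the constant `Ū₀(c)⁻¹`, then ✓`MatrixLog.analyticAt_mlog`). [cite: Balaban1985Averaging, (11)–(12) p.19, Prop. 4 p.38; Balaban1987RG1, (0.4) p.253] -/
theorem analyticAt_chart (hj : j + 1 ≤ P.m + P.K) (U₀ : GaugeField P j 𝔸ˣ) (c : PBond P (j + 1)) {s₀ R : ℝ} (hs₀ : 0 ≤ s₀)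
    (hwin : 1000 * (((P.d + 2) * P.L : ℕ) : ℝ) * (2 * s₀ + 3 * R) ≤ 1)
    (hU₀ : ∀ b : PBond P j, (blockOf b.src = c.src ∨ blockOf b.src = c.tgt) → (blockOf b.tgt = c.src ∨ blockOf b.tgt = c.tgt) → ‖((U₀ b : 𝔸ˣ) : 𝔸) - 1‖ ≤ s₀)
    {y₀ : PBond P j → 𝔸} (hy₀ : ‖y₀‖ < R) :
    AnalyticAt ℂ (fun y : PBond P j → 𝔸 =>
      mlog (((dbarCovU U₀ (fun b => expUnit (y b) * U₀ b) c : 𝔸ˣ) : 𝔸) * (((emlAvgU U₀ c)⁻¹ : 𝔸ˣ) : 𝔸))) y₀ := by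
  have hR : 0 ≤ R := (norm_nonneg _).trans hy₀.le
  obtain ⟨-, h4, h16, hR1, hs₀h, hB⟩ := window_numerics (P := P) hs₀ hR hwin
  have hyb : ∀ b : PBond P j, ‖y₀ b‖ ≤ R := fun b => (norm_le_pi_norm y₀ b).trans hy₀.le
  have hpert : ∀ b : PBond P j, (blockOf b.src = c.src ∨ blockOf b.src = c.tgt) → (blockOf b.tgt = c.src ∨ blockOf b.tgt = c.tgt) →
      ‖((expUnit (y₀ b) * U₀ b : 𝔸ˣ) : 𝔸) - 1‖ ≤ s₀ + 3 * R :=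
    fun b h1 h2 => (norm_pert_sub_le (hs₀ := hs₀h) (hρ := hR1) (hU₀ b h1 h2) (hyb b)).2
  have hs₁0 : 0 ≤ s₀ + 3 * R := by positivity
  -- bondwise analyticity of the family
  have hF : ∀ b : PBond P j, AnalyticAt ℂ (fun y : PBond P j → 𝔸 => ((expUnit (y b) * U₀ b : 𝔸ˣ) : 𝔸)) y₀ := by
    intro b
    have hlin : AnalyticAt ℂ (fun y : PBond P j → 𝔸 => y b) y₀ := (ContinuousLinearMap.proj (R := ℂ) (φ := fun _ : PBond P j => 𝔸) b).analyticAt y₀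
    have hfun : (fun y : PBond P j → 𝔸 => ((expUnit (y b) * U₀ b : 𝔸ˣ) : 𝔸)) = fun y => exp (y b) * ((U₀ b : 𝔸ˣ) : 𝔸) := by
      funext y; rw [Units.val_mul, val_expUnit]
    rw [hfun]
    exact (AnalyticAt.comp_of_eq (exp_analytic _) hlin rfl).mul analyticAt_const
  -- the three «within 1 of 1» rows at `y₀`
  have hloop : ∀ i : Idx P, ‖((loopHolU (fun b => expUnit (y₀ b) * U₀ b) c i : 𝔸ˣ) : 𝔸) - 1‖ < 1 :=
    norm_loopHolU_sub_one_lt_one hj c hs₁0 h4 hpert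
  have hsrc : ∀ i : Idx P, ‖((tstairU U₀ (fun b => expUnit (y₀ b) * U₀ b) c.src i : 𝔸ˣ) : 𝔸) - 1‖ < 1 :=
    norm_tstairU_sub_one_lt_one hj U₀ _ c.src hs₁0 h16 (fun b h1 h2 => hpert b (Or.inl h1) (Or.inl h2))
      (fun b h1 h2 => (hU₀ b (Or.inl h1) (Or.inl h2)).trans (by linarith))
  have htgt : ∀ i : Idx P, ‖((tstairU U₀ (fun b => expUnit (y₀ b) * U₀ b) c.tgt i : 𝔸ˣ) : 𝔸) - 1‖ < 1 :=
    norm_tstairU_sub_one_lt_one hj U₀ _ c.tgt hs₁0 h16 (fun b h1 h2 => hpert b (Or.inr h1) (Or.inr h2))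
      (fun b h1 h2 => (hU₀ b (Or.inr h1) (Or.inr h2)).trans (by linarith))
  have hdbar : AnalyticAt ℂ (fun y : PBond P j → 𝔸 => ((dbarCovU U₀ (fun b => expUnit (y b) * U₀ b) c : 𝔸ˣ) : 𝔸)) y₀ :=
    analyticAt_coe_dbarCovU_of_twoBlock hj (F := fun (y : PBond P j → 𝔸) b => expUnit (y b) * U₀ b) U₀ c (fun b _ _ => hF b) hloop hsrc htgt
  have hprod : AnalyticAt ℂ (fun y : PBond P j → 𝔸 =>
      ((dbarCovU U₀ (fun b => expUnit (y b) * U₀ b) c : 𝔸ˣ) : 𝔸) * (((emlAvgU U₀ c)⁻¹ : 𝔸ˣ) : 𝔸)) y₀ := hdbar.mul analyticAt_const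
  -- the value at `y₀` is within `B ≤ 1/40 < 1` of `1`
  have hnear : ‖((dbarCovU U₀ (fun b => expUnit (y₀ b) * U₀ b) c : 𝔸ˣ) : 𝔸) * (((emlAvgU U₀ c)⁻¹ : 𝔸ˣ) : 𝔸) - 1‖ < 1 :=
    (norm_ratio_sub_one_le hj U₀ c hs₀ hR le_rfl hwin hU₀ (fun b _ _ => hyb b)).trans_lt (by linarith)
  have hcomp : AnalyticAt ℂ (mlog ∘ fun y : PBond P j → 𝔸 =>
      ((dbarCovU U₀ (fun b => expUnit (y b) * U₀ b) c : 𝔸ˣ) : 𝔸) * (((emlAvgU U₀ c)⁻¹ : 𝔸ˣ) : 𝔸)) y₀ :=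
    AnalyticAt.comp_of_eq (MatrixLog.analyticAt_mlog hnear) hprod rfl
  exact hcomp

/-- **THE CHART IS BOUNDED BY `2B` ON THE BALL** (`‖log u‖ ≤ 2‖u − 1‖` for `‖u − 1‖ ≤ ½`). [cite: Balaban1985Averaging, (121)–(125) p.36] -/
theorem norm_chart_le (hj : j + 1 ≤ P.m + P.K) (U₀ : GaugeField P j 𝔸ˣ) (c : PBond P (j + 1)) {s₀ R : ℝ} (hs₀ : 0 ≤ s₀)
    (hwin : 1000 * (((P.d + 2) * P.L : ℕ) : ℝ) * (2 * s₀ + 3 * R) ≤ 1)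
    (hU₀ : ∀ b : PBond P j, (blockOf b.src = c.src ∨ blockOf b.src = c.tgt) → (blockOf b.tgt = c.src ∨ blockOf b.tgt = c.tgt) → ‖((U₀ b : 𝔸ˣ) : 𝔸) - 1‖ ≤ s₀)
    {y : PBond P j → 𝔸} (hy : ‖y‖ < R) :
    ‖mlog (((dbarCovU U₀ (fun b => expUnit (y b) * U₀ b) c : 𝔸ˣ) : 𝔸) * (((emlAvgU U₀ c)⁻¹ : 𝔸ˣ) : 𝔸))‖ ≤
      2 * ((P.L : ℝ) * (3 * R) + 22100 * (((P.d + 2) * P.L : ℕ) : ℝ) ^ 2 * (s₀ + (s₀ + 3 * R)) ^ 2) := by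
  have hR : 0 ≤ R := (norm_nonneg _).trans hy.le
  obtain ⟨-, -, -, -, -, hB⟩ := window_numerics (P := P) hs₀ hR hwin
  have h := norm_ratio_sub_one_le hj U₀ c hs₀ hR le_rfl hwin hU₀ (fun b _ _ => (norm_le_pi_norm y b).trans hy.le)
  exact (norm_mlog_le_two_mul (h.trans (hB.trans (by norm_num)))).trans (by linarith)

/-- **THE DERIVATIVE AT `0` IS LOCAL TOO**: if `y` and `y′` agree on the read set of `c`, `D|₀(chart)·y = D|₀(chart)·y′` — along the complex line `t ↦ t(y − y′)` the chart is
constantly `0` (locality + `chart_zero`), so the directional derivative vanishes. [cite: Balaban1985Averaging, (87)–(92) p.31] -/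
theorem fderiv_chart_congr (hj : j + 1 ≤ P.m + P.K) (U₀ : GaugeField P j 𝔸ˣ) (c : PBond P (j + 1)) {s₀ R : ℝ} (hs₀ : 0 ≤ s₀) (hR : 0 < R)
    (hwin : 1000 * (((P.d + 2) * P.L : ℕ) : ℝ) * (2 * s₀ + 3 * R) ≤ 1)
    (hU₀ : ∀ b : PBond P j, (blockOf b.src = c.src ∨ blockOf b.src = c.tgt) → (blockOf b.tgt = c.src ∨ blockOf b.tgt = c.tgt) → ‖((U₀ b : 𝔸ˣ) : 𝔸) - 1‖ ≤ s₀)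
    {y y' : PBond P j → 𝔸}
    (hyy' : ∀ b : PBond P j, (blockOf b.src = c.src ∨ blockOf b.src = c.tgt) → (blockOf b.tgt = c.src ∨ blockOf b.tgt = c.tgt) → y b = y' b) :
    fderiv ℂ (fun y : PBond P j → 𝔸 =>
        mlog (((dbarCovU U₀ (fun b => expUnit (y b) * U₀ b) c : 𝔸ˣ) : 𝔸) * (((emlAvgU U₀ c)⁻¹ : 𝔸ˣ) : 𝔸))) 0 y =
      fderiv ℂ (fun y : PBond P j → 𝔸 =>
        mlog (((dbarCovU U₀ (fun b => expUnit (y b) * U₀ b) c : 𝔸ˣ) : 𝔸) * (((emlAvgU U₀ c)⁻¹ : 𝔸ˣ) : 𝔸))) 0 y' := by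
  set G : (PBond P j → 𝔸) → 𝔸 := fun y =>
    mlog (((dbarCovU U₀ (fun b => expUnit (y b) * U₀ b) c : 𝔸ˣ) : 𝔸) * (((emlAvgU U₀ c)⁻¹ : 𝔸ˣ) : 𝔸)) with hGdef
  have hG0 : G 0 = 0 := chart_zero U₀ c
  have hGd : HasFDerivAt G (fderiv ℂ G 0) 0 :=
    ((analyticAt_chart hj U₀ c hs₀ hwin hU₀ (y₀ := 0) (by rwa [norm_zero])).differentiableAt).hasFDerivAt
  set v : PBond P j → 𝔸 := y - y' with hv
  -- along the line `t ↦ t • v` the chart is identically `0`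
  have hline : (fun t : ℂ => G (t • v)) = fun _ => 0 := by
    funext t
    have h := chart_congr hj U₀ c (y := t • v) (y' := 0) (fun b h1 h2 => by
      rw [hv, Pi.smul_apply, Pi.sub_apply, hyy' b h1 h2, sub_self, smul_zero, Pi.zero_apply])
    rw [hGdef] at hG0
    exact h.trans hG0
  have hpath : HasDerivAt (fun t : ℂ => G (t • v)) (fderiv ℂ G 0 v) 0 := by
    have hp : HasDerivAt (fun t : ℂ => t • v) v 0 := by simpa using (hasDerivAt_id (0 : ℂ)).smul_const v
    exact HasFDerivAt.comp_hasDerivAt_of_eq 0 hGd hp (by rw [zero_smul])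
  rw [hline] at hpath
  have hzero : fderiv ℂ G 0 v = 0 := hpath.unique (hasDerivAt_const 0 (0 : 𝔸)) |>.symm ▸ rfl
  have : fderiv ℂ G 0 y - fderiv ℂ G 0 y' = 0 := by rw [← map_sub, ← hv]; exact hzero
  exact sub_eq_zero.1 this

/-! ## §3 ★★ The per-bond defect in local mass currency -/

/-- ★★ **THE ONE-STEP COVARIANT DEFECT AT ONE COARSE BOND, LOCAL MASS² ON THE RIGHT** — at a background within `s₀` of `1` on the read set of `c`, for `‖y b‖ ≤ s` there,
`2s < R`, `1000ℓ(2s₀+3R) ≤ 1`: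
`‖log[(dbarCovU U₀ (e^{y}U₀))(c)·Ū₀(c)⁻¹] − D|₀(…)·y‖ ≤ (80B∕R²)·Σ_{b read by c}‖y b‖²`, `B = 3LR + 22100ℓ²(2s₀+3R)²` (Cauchy estimate ✓`norm_le_mul_sq` at the localised
field). [cite: Balaban1985Averaging, (89) p.31, (121)–(125) p.36, Prop. 4 p.38; Balaban1985Variational, (44)–(46) p.285] -/
theorem norm_chart_sub_fderiv_le_localMass (hj : j + 1 ≤ P.m + P.K) (U₀ : GaugeField P j 𝔸ˣ) (c : PBond P (j + 1)) {s₀ R s : ℝ}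
    (hs₀ : 0 ≤ s₀) (hR : 0 < R) (hwin : 1000 * (((P.d + 2) * P.L : ℕ) : ℝ) * (2 * s₀ + 3 * R) ≤ 1) (hs : 0 ≤ s) (hsR : 2 * s < R)
    (hU₀ : ∀ b : PBond P j, (blockOf b.src = c.src ∨ blockOf b.src = c.tgt) → (blockOf b.tgt = c.src ∨ blockOf b.tgt = c.tgt) → ‖((U₀ b : 𝔸ˣ) : 𝔸) - 1‖ ≤ s₀)
    {y : PBond P j → 𝔸}
    (hy : ∀ b : PBond P j, (blockOf b.src = c.src ∨ blockOf b.src = c.tgt) → (blockOf b.tgt = c.src ∨ blockOf b.tgt = c.tgt) → ‖y b‖ ≤ s) :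
    ‖mlog (((dbarCovU U₀ (fun b => expUnit (y b) * U₀ b) c : 𝔸ˣ) : 𝔸) * (((emlAvgU U₀ c)⁻¹ : 𝔸ˣ) : 𝔸)) -
        fderiv ℂ (fun y : PBond P j → 𝔸 =>
          mlog (((dbarCovU U₀ (fun b => expUnit (y b) * U₀ b) c : 𝔸ˣ) : 𝔸) * (((emlAvgU U₀ c)⁻¹ : 𝔸ˣ) : 𝔸))) 0 y‖ ≤
      80 * ((P.L : ℝ) * (3 * R) + 22100 * (((P.d + 2) * P.L : ℕ) : ℝ) ^ 2 * (s₀ + (s₀ + 3 * R)) ^ 2) / R ^ 2 *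
        ∑ b ∈ (univ.filter fun b : PBond P j =>
          (blockOf b.src = c.src ∨ blockOf b.src = c.tgt) ∧ (blockOf b.tgt = c.src ∨ blockOf b.tgt = c.tgt)), ‖y b‖ ^ 2 := by
  classical
  set G : (PBond P j → 𝔸) → 𝔸 := fun y =>
    mlog (((dbarCovU U₀ (fun b => expUnit (y b) * U₀ b) c : 𝔸ˣ) : 𝔸) * (((emlAvgU U₀ c)⁻¹ : 𝔸ˣ) : 𝔸)) with hGdef
  set Bc : ℝ := (P.L : ℝ) * (3 * R) + 22100 * (((P.d + 2) * P.L : ℕ) : ℝ) ^ 2 * (s₀ + (s₀ + 3 * R)) ^ 2 with hBc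
  have hBc0 : 0 ≤ Bc := by positivity
  -- the read set and the localised field
  set Rd : Finset (PBond P j) := univ.filter fun b : PBond P j =>
    (blockOf b.src = c.src ∨ blockOf b.src = c.tgt) ∧ (blockOf b.tgt = c.src ∨ blockOf b.tgt = c.tgt) with hRd
  have hmemRd : ∀ b : PBond P j, (blockOf b.src = c.src ∨ blockOf b.src = c.tgt) → (blockOf b.tgt = c.src ∨ blockOf b.tgt = c.tgt) → b ∈ Rd :=
    fun b h1 h2 => by rw [hRd, Finset.mem_filter]; exact ⟨Finset.mem_univ _, h1, h2⟩
  obtain ⟨r, hr0, hyr, hrs, hr2⟩ := exists_local_radius Rd y hs (fun b hb => by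
    rw [hRd, Finset.mem_filter] at hb; exact hy b hb.2.1 hb.2.2)
  set yc : PBond P j → 𝔸 := fun b => if b ∈ Rd then y b else 0 with hyc
  have hyc_agree : ∀ b : PBond P j, (blockOf b.src = c.src ∨ blockOf b.src = c.tgt) → (blockOf b.tgt = c.src ∨ blockOf b.tgt = c.tgt) → y b = yc b :=
    fun b h1 h2 => by rw [hyc]; simp only [if_pos (hmemRd b h1 h2)]
  have hyc_norm : ‖yc‖ ≤ r := by
    refine (pi_norm_le_iff_of_nonneg hr0).2 fun b => ?_
    by_cases hb : b ∈ Rd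
    · simp only [hyc, if_pos hb]; exact hyr b hb
    · simp only [hyc, if_neg hb, norm_zero]; exact hr0
  have hycR : ‖yc‖ < R / 2 := lt_of_le_of_lt (hyc_norm.trans hrs) (by linarith)
  -- the Cauchy letter at `Ct := G − DG(0)`
  have han : AnalyticOnNhd ℂ G (ball (0 : PBond P j → 𝔸) R) := fun y₀ hy₀ =>
    analyticAt_chart hj U₀ c hs₀ hwin hU₀ (mem_ball_zero_iff.1 hy₀)
  have hbd : ∀ y₀ ∈ ball (0 : PBond P j → 𝔸) R, ‖G y₀‖ ≤ 2 * Bc := fun y₀ hy₀ =>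
    norm_chart_le hj U₀ c hs₀ hwin hU₀ (mem_ball_zero_iff.1 hy₀)
  have hG0 : G 0 = 0 := chart_zero U₀ c
  have hDn : ‖fderiv ℂ G 0‖ ≤ 4 * (2 * Bc) / R :=
    norm_fderiv_le_of_bound hR han.differentiableOn hbd (Y := 0) (by rw [norm_zero]; positivity)
  set Ct : (PBond P j → 𝔸) → 𝔸 := fun y => G y - fderiv ℂ G 0 y with hCt
  have hCan : AnalyticOnNhd ℂ Ct (ball (0 : PBond P j → 𝔸) R) := fun y₀ hy₀ =>
    (han y₀ hy₀).sub ((fderiv ℂ G 0).analyticAt y₀)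
  have hCbd : ∀ y₀ ∈ ball (0 : PBond P j → 𝔸) R, ‖Ct y₀‖ ≤ 10 * Bc := by
    intro y₀ hy₀
    have hy₀R : ‖y₀‖ < R := mem_ball_zero_iff.1 hy₀
    have h1 := hbd y₀ hy₀
    have h2 : ‖fderiv ℂ G 0 y₀‖ ≤ 4 * (2 * Bc) / R * R :=
      ((fderiv ℂ G 0).le_opNorm y₀).trans (mul_le_mul hDn hy₀R.le (norm_nonneg _) (by positivity))
    have h3 : 4 * (2 * Bc) / R * R = 8 * Bc := by rw [div_mul_cancel₀ (4 * (2 * Bc)) hR.ne']; ring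
    calc ‖Ct y₀‖ ≤ ‖G y₀‖ + ‖fderiv ℂ G 0 y₀‖ := norm_sub_le _ _
      _ ≤ 2 * Bc + 8 * Bc := add_le_add h1 (h2.trans h3.le)
      _ = 10 * Bc := by ring
  have hC0 : Ct 0 = 0 := by simp only [hCt, hG0, map_zero, sub_zero]
  have hC1 : fderiv ℂ Ct 0 = 0 := by
    have hGd : HasFDerivAt G (fderiv ℂ G 0) 0 := ((han 0 (mem_ball_self hR)).differentiableAt).hasFDerivAt
    have h := hGd.sub (fderiv ℂ G 0).hasFDerivAt
    rw [sub_self] at h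
    exact h.fderiv
  have key := norm_le_mul_sq hR hCan hCbd hC0 hC1 hycR
  -- localise: `G y = G yc`, `DG(0) y = DG(0) yc`
  have hGloc : G y = G yc := chart_congr hj U₀ c hyc_agree
  have hDloc : fderiv ℂ G 0 y = fderiv ℂ G 0 yc := fderiv_chart_congr hj U₀ c hs₀ hR hwin hU₀ hyc_agree
  have hval : G y - fderiv ℂ G 0 y = Ct yc := by rw [hCt, hGloc, hDloc]
  rw [show mlog (((dbarCovU U₀ (fun b => expUnit (y b) * U₀ b) c : 𝔸ˣ) : 𝔸) * (((emlAvgU U₀ c)⁻¹ : 𝔸ˣ) : 𝔸)) -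
      fderiv ℂ G 0 y = G y - fderiv ℂ G 0 y from rfl, hval]
  refine key.trans ?_
  have hsq : ‖yc‖ ^ 2 ≤ ∑ b ∈ Rd, ‖y b‖ ^ 2 := (pow_le_pow_left₀ (norm_nonneg _) hyc_norm 2).trans hr2
  have hcoef : 8 * (10 * Bc) / R ^ 2 = 80 * Bc / R ^ 2 := by ring
  rw [hcoef]
  exact mul_le_mul_of_nonneg_left hsq (by positivity)

/-! ## §4 ★★★ Summed over the coarse bonds; the field-valued reading -/

/-- ★★★ **THE ONE-STEP COVARIANT DEFECT IN MASS CURRENCY** — at a background within `s₀` of `1` on every bond, for `‖y b‖ ≤ s`, `2s < R`, `1000ℓ(2s₀+3R) ≤ 1`: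
`Σ_c ‖log[(dbarCovU U₀ (e^{y}U₀))(c)·Ū₀(c)⁻¹] − D|₀(…)·y‖ ≤ (80B∕R²)·(2d)·Σ_b ‖y b‖²` — the `hr : r_l ≤ C_D·M_l` row of ✓`jointRow_of_levelMasses` for the covariant step.
[cite: Balaban1985Averaging, (89) p.31, (121)–(125) p.36, Prop. 4 p.38; Balaban1985Variational, (44)–(46) p.285, Prop. 7 p.299] -/
theorem sum_norm_chart_sub_fderiv_le (hj : j + 1 ≤ P.m + P.K) (U₀ : GaugeField P j 𝔸ˣ) {s₀ R s : ℝ}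
    (hs₀ : 0 ≤ s₀) (hR : 0 < R) (hwin : 1000 * (((P.d + 2) * P.L : ℕ) : ℝ) * (2 * s₀ + 3 * R) ≤ 1) (hs : 0 ≤ s) (hsR : 2 * s < R)
    (hU₀ : ∀ b : PBond P j, ‖((U₀ b : 𝔸ˣ) : 𝔸) - 1‖ ≤ s₀) {y : PBond P j → 𝔸} (hy : ∀ b : PBond P j, ‖y b‖ ≤ s) :
    ∑ c : PBond P (j + 1), ‖mlog (((dbarCovU U₀ (fun b => expUnit (y b) * U₀ b) c : 𝔸ˣ) : 𝔸) * (((emlAvgU U₀ c)⁻¹ : 𝔸ˣ) : 𝔸)) -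
        fderiv ℂ (fun y : PBond P j → 𝔸 =>
          mlog (((dbarCovU U₀ (fun b => expUnit (y b) * U₀ b) c : 𝔸ˣ) : 𝔸) * (((emlAvgU U₀ c)⁻¹ : 𝔸ˣ) : 𝔸))) 0 y‖ ≤
      80 * ((P.L : ℝ) * (3 * R) + 22100 * (((P.d + 2) * P.L : ℕ) : ℝ) ^ 2 * (s₀ + (s₀ + 3 * R)) ^ 2) / R ^ 2 * (2 * P.d) *
        ∑ b : PBond P j, ‖y b‖ ^ 2 := by
  classical
  have hmult := sum_read_le_two_d_mul (P := P) (j := j) (fun b => ‖y b‖ ^ 2) (fun b => sq_nonneg _)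
  have hC0 : 0 ≤ 80 * ((P.L : ℝ) * (3 * R) + 22100 * (((P.d + 2) * P.L : ℕ) : ℝ) ^ 2 * (s₀ + (s₀ + 3 * R)) ^ 2) / R ^ 2 := by positivity
  calc _ ≤ ∑ c : PBond P (j + 1), 80 * ((P.L : ℝ) * (3 * R) + 22100 * (((P.d + 2) * P.L : ℕ) : ℝ) ^ 2 * (s₀ + (s₀ + 3 * R)) ^ 2) / R ^ 2 *
          ∑ b ∈ (univ.filter fun b : PBond P j =>
            (blockOf b.src = c.src ∨ blockOf b.src = c.tgt) ∧ (blockOf b.tgt = c.src ∨ blockOf b.tgt = c.tgt)), ‖y b‖ ^ 2 :=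
        Finset.sum_le_sum fun c _ => norm_chart_sub_fderiv_le_localMass hj U₀ c hs₀ hR hwin hs hsR (fun b _ _ => hU₀ b) (fun b _ _ => hy b)
    _ = 80 * ((P.L : ℝ) * (3 * R) + 22100 * (((P.d + 2) * P.L : ℕ) : ℝ) ^ 2 * (s₀ + (s₀ + 3 * R)) ^ 2) / R ^ 2 *
          ∑ c : PBond P (j + 1), ∑ b ∈ (univ.filter fun b : PBond P j =>
            (blockOf b.src = c.src ∨ blockOf b.src = c.tgt) ∧ (blockOf b.tgt = c.src ∨ blockOf b.tgt = c.tgt)), ‖y b‖ ^ 2 := by rw [Finset.mul_sum]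
    _ ≤ 80 * ((P.L : ℝ) * (3 * R) + 22100 * (((P.d + 2) * P.L : ℕ) : ℝ) ^ 2 * (s₀ + (s₀ + 3 * R)) ^ 2) / R ^ 2 *
          (2 * P.d * ∑ b : PBond P j, ‖y b‖ ^ 2) := mul_le_mul_of_nonneg_left hmult hC0
    _ = _ := by ring

/-- ★★★ **THE FIELD-VALUED READING** — with `f(y) := (c ↦ log[(dbarCovU U₀ (e^{y}U₀))(c)·Ū₀(c)⁻¹])` and `T := fderiv ℂ f 0` (a continuous linear map on fields, the `T_l`
F0″ telescopes with): `Σ_c ‖f(y)(c) − (T y)(c)‖ ≤ (80B∕R²)·(2d)·Σ_b ‖y b‖²` (componentwise `fderiv_pi`). [cite: Balaban1985Averaging, (89) p.31, Prop. 4 p.38; Balaban1985Variational, (44)–(46) p.285] -/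
theorem sum_norm_chartField_sub_fderiv_apply_le (hj : j + 1 ≤ P.m + P.K) (U₀ : GaugeField P j 𝔸ˣ) {s₀ R s : ℝ}
    (hs₀ : 0 ≤ s₀) (hR : 0 < R) (hwin : 1000 * (((P.d + 2) * P.L : ℕ) : ℝ) * (2 * s₀ + 3 * R) ≤ 1) (hs : 0 ≤ s) (hsR : 2 * s < R)
    (hU₀ : ∀ b : PBond P j, ‖((U₀ b : 𝔸ˣ) : 𝔸) - 1‖ ≤ s₀) {y : PBond P j → 𝔸} (hy : ∀ b : PBond P j, ‖y b‖ ≤ s) :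
    ∑ c : PBond P (j + 1), ‖mlog (((dbarCovU U₀ (fun b => expUnit (y b) * U₀ b) c : 𝔸ˣ) : 𝔸) * (((emlAvgU U₀ c)⁻¹ : 𝔸ˣ) : 𝔸)) -
        fderiv ℂ (fun (y : PBond P j → 𝔸) (c : PBond P (j + 1)) =>
          mlog (((dbarCovU U₀ (fun b => expUnit (y b) * U₀ b) c : 𝔸ˣ) : 𝔸) * (((emlAvgU U₀ c)⁻¹ : 𝔸ˣ) : 𝔸))) 0 y c‖ ≤
      80 * ((P.L : ℝ) * (3 * R) + 22100 * (((P.d + 2) * P.L : ℕ) : ℝ) ^ 2 * (s₀ + (s₀ + 3 * R)) ^ 2) / R ^ 2 * (2 * P.d) *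
        ∑ b : PBond P j, ‖y b‖ ^ 2 := by
  have hdiff : ∀ c : PBond P (j + 1), DifferentiableAt ℂ (fun y : PBond P j → 𝔸 =>
      mlog (((dbarCovU U₀ (fun b => expUnit (y b) * U₀ b) c : 𝔸ˣ) : 𝔸) * (((emlAvgU U₀ c)⁻¹ : 𝔸ˣ) : 𝔸))) 0 := fun c =>
    (analyticAt_chart hj U₀ c hs₀ hwin (fun b _ _ => hU₀ b) (y₀ := 0) (by rw [norm_zero]; exact hR)).differentiableAt
  have hpi : ∀ c : PBond P (j + 1), fderiv ℂ (fun (y : PBond P j → 𝔸) (c : PBond P (j + 1)) =>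
        mlog (((dbarCovU U₀ (fun b => expUnit (y b) * U₀ b) c : 𝔸ˣ) : 𝔸) * (((emlAvgU U₀ c)⁻¹ : 𝔸ˣ) : 𝔸))) 0 y c =
      fderiv ℂ (fun y : PBond P j → 𝔸 =>
        mlog (((dbarCovU U₀ (fun b => expUnit (y b) * U₀ b) c : 𝔸ˣ) : 𝔸) * (((emlAvgU U₀ c)⁻¹ : 𝔸ˣ) : 𝔸))) 0 y := by
    intro c
    rw [fderiv_pi hdiff]
    rfl
  simp only [hpi]
  exact sum_norm_chart_sub_fderiv_le hj U₀ hs₀ hR hwin hs hsR hU₀ hy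

end Summit.QuantumFields.YangMills.Theorems.Prop7TwistedOneStepDefectCov

end
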